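import Summits.AtomisticToContinuum.Crystallization.Theorems.ChargedEnergyGapStationSchema
import Summits.AtomisticToContinuum.Crystallization.Theorems.ChargedEnergyGapBspKernel
import Summits.AtomisticToContinuum.Crystallization.Theorems.ChargedEnergyGapCellChecker
import HarnessLib

/-!
# ChargedEnergyGap · NODE 110E «StationCert» — ONE station of door D5 as data, its `Bool` checker, ONE soundness theorem (memo §10–§17)

decomp-a2c lens-3 g92.  Imports lane 110D «StationSchema» (rows), lane 110C «BspKernel» (partition), tree 108C «CellChecker» (`BasisCert`, `AxisCap`,
`CostCellCert.capCheck(_sound)`, `costCheck(_sound)`), and through them N105 `roofVal_T75_le_price`, N106 `feetHoleCost_le_of_roofVal_le`,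
`roofVal_T75_le_of_corners`, `cap_at_chargeDepth`.  A `StationCert` = a `StationRowsCert` (H-description) + unit `u`, station `capLB` and 108C `AxisCap`
blocks + LP `bases` + `boxes` + leaf-local `caps` + a `Bsp Leaf` (HYBRID form «H», four leaf kinds).  CONE leaf `cone j` / `coneL j k`: needs the six
cone facets `−(B⁻¹W)ᵢ ≤ 0` and the verdict `kfac·Σ_q y_B(q)·W_q ≤ capLB·u` (`payload_sound`: `B·B⁻¹ = I` in ℚ + N105 — the roof piece is FIXED on the
cone); BOX leaf `box j` / `boxL j k`: needs `L_q ≤ W_q ≤ U_q` (`box_payload_sound`: 64 corner certificates + N106 convexity); the LOCAL kinds (110F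
«LocalLeaf» folded in) also need the twelve depth rows of their sub-box `caps[k]` and compare with the LOCAL cap floor (its own three 108C cap blocks).
★★★ `StationCert.sound`: `check = true` ⇒ the (T¹ᶜ) inequality for EVERY `ρ ∈ [rho0, rho1]` and EVERY chart-realisable positive tuple in the
station's box — the full transverse extent included; the census never tiles it (FINDING TRANSVERSE-BULK-92).
[SPLIT beneath (T¹ᶜ) (no EQUIV introduced) · D5c · UNDECIDED(test = (D¹)) unchanged.] -/

namespace Summit.AtomisticToContinuum.Crystallization.Theorems.ChargedEnergyGapChartDial

/-! ## §110E.1 The basis payload: `B·B⁻¹ = I` in ℚ, cone rows, price -/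
/-- Explicit six-term sum over `Fin 6` (kernel-friendly; the slot-indexed `sum6` of 109B «EmptyCell» is a different declaration). -/
def sumFin6 (f : Fin 6 → ℚ) : ℚ := f 0 + f 1 + f 2 + f 3 + f 4 + f 5

/-- `sumFin6` is the `Fintype` sum. -/
theorem cast_sumFin6 (f : Fin 6 → ℚ) : ((sumFin6 f : ℚ) : ℝ) = ∑ i, (f i : ℝ) := by
  rw [Fin.sum_univ_six]; simp only [sumFin6]; push_cast; ring

/-- Row `i` of `B⁻¹`. -/
def BasisCert.r (B : BasisCert) (i : Fin 6) : Fin 3 × Bool → ℚ :=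
  match i with
  | ⟨0, _⟩ => B.r₀ | ⟨1, _⟩ => B.r₁ | ⟨2, _⟩ => B.r₂ | ⟨3, _⟩ => B.r₃ | ⟨4, _⟩ => B.r₄ | _ => B.r₅

/-- Column `i` of `B`. -/
def BasisCert.col (B : BasisCert) (i : Fin 6) : ColRef :=
  match i with
  | ⟨0, _⟩ => B.c₀ | ⟨1, _⟩ => B.c₁ | ⟨2, _⟩ => B.c₂ | ⟨3, _⟩ => B.c₃ | ⟨4, _⟩ => B.c₄ | _ => B.c₅

/-- The six table rows of the basis columns, if every index is in range. -/
def BasisCert.rows? (B : BasisCert) : Option (Fin 6 → (Fin 3 × Bool → ℚ) × ℚ) :=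
  match T75Q[B.c₀.k]?, T75Q[B.c₁.k]?, T75Q[B.c₂.k]?, T75Q[B.c₃.k]?, T75Q[B.c₄.k]?, T75Q[B.c₅.k]? with
  | some e₀, some e₁, some e₂, some e₃, some e₄, some e₅ =>
    some fun i => match i with
      | ⟨0, _⟩ => e₀ | ⟨1, _⟩ => e₁ | ⟨2, _⟩ => e₂ | ⟨3, _⟩ => e₃ | ⟨4, _⟩ => e₄ | _ => e₅
  | _, _, _, _, _, _ => none

/-- The rows found are table rows. -/
theorem BasisCert.rows?_mem {B : BasisCert} {e : Fin 6 → (Fin 3 × Bool → ℚ) × ℚ} (h : B.rows? = some e) : ∀ i, castRow (e i) ∈ T75 := by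
  unfold BasisCert.rows? at h
  split at h
  · next e₀ e₁ e₂ e₃ e₄ e₅ k₀ k₁ k₂ k₃ k₄ k₅ =>
    obtain rfl := (Option.some.inj h).symm
    intro i
    match i with
    | ⟨0, _⟩ => exact castRow_mem_T75_of_getElem? k₀
    | ⟨1, _⟩ => exact castRow_mem_T75_of_getElem? k₁
    | ⟨2, _⟩ => exact castRow_mem_T75_of_getElem? k₂
    | ⟨3, _⟩ => exact castRow_mem_T75_of_getElem? k₃
    | ⟨4, _⟩ => exact castRow_mem_T75_of_getElem? k₄
    | ⟨5, _⟩ => exact castRow_mem_T75_of_getElem? k₅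
  · exact absurd h (by simp)

/-- ★ `B·B⁻¹ = I`: the 36 rational identities `Σᵢ eᵢ(relabel gᵢ σᵢ p)·rᵢ(q) = [p = q]`. -/
def BasisCert.invCheck (B : BasisCert) : Bool :=
  match B.rows? with
  | none => false
  | some e => allSlots fun p => allSlots fun q =>
      decide (sumFin6 (fun i => (e i).1 (relabel (B.col i).g (B.col i).s p) * B.r i q) = if p = q then 1 else 0)

/-- Soundness of `invCheck`: the cast data form an `IsBasisInverse`. -/
theorem BasisCert.invCheck_sound {B : BasisCert} (h : B.invCheck = true) :
    ∃ e, B.rows? = some e ∧ IsBasisInverse (fun i => castRow (e i)) (fun i => (B.col i).g) (fun i => (B.col i).s) (fun i q => (B.r i q : ℝ)) := by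
  unfold BasisCert.invCheck at h
  split at h
  · exact absurd h Bool.false_ne_true
  · next e he =>
    refine ⟨e, he, fun p q => ?_⟩
    have hpq := (allSlots_iff _).1 ((allSlots_iff _).1 h p) q
    have hq := qle (le_of_eq (of_decide_eq_true hpq)); have hq' := qle (ge_of_eq (of_decide_eq_true hpq))
    rw [cast_sumFin6] at hq hq'
    simp only [roofBasisMat, castW_apply]
    push_cast at hq hq'
    have : ((if p = q then (1 : ℚ) else 0 : ℚ) : ℝ) = if p = q then 1 else 0 := by split_ifs <;> simp
    rw [this] at hq hq'
    exact le_antisymm hq hq'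

/-- The price `y_B(q) = Σᵢ sᵢ·rᵢ(q)`. -/
def BasisCert.price (B : BasisCert) (e : Fin 6 → (Fin 3 × Bool → ℚ) × ℚ) (q : Fin 3 × Bool) : ℚ := sumFin6 fun i => (e i).2 * B.r i q

/-- A row on the six weight variables: `Σ_q f(q)·W_q ≤ b` (weights at indices `14..19`). -/
def wRow (f : Fin 3 × Bool → ℚ) (b : ℚ) : LRow :=
  ⟨axpy (f (0, true)) (unitRow 14 1) <| axpy (f (0, false)) (unitRow 15 1) <| axpy (f (1, true)) (unitRow 16 1) <|
      axpy (f (1, false)) (unitRow 17 1) <| axpy (f (2, true)) (unitRow 18 1) <| unitRow 19 (f (2, false)), b⟩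

/-- [formal bookkeeping] the bound of a `wRow`. -/
@[simp] theorem wRow_b (f : Fin 3 × Bool → ℚ) (b : ℚ) : (wRow f b).b = b := rfl

/-- `wRow` at the valuation is the weight functional. -/
theorem linAt_wRow (f : Fin 3 × Bool → ℚ) (b : ℚ) (dt : (Fin 3 → ℤ) → ℝ) :
    linAt (wRow f b).a (sval dt) 0 = ∑ q, (f q : ℝ) * vtxW 160 dt 0 q := by
  simp only [wRow, linAt_axpy, linAt_unitRow]
  rw [Fintype.sum_prod_type, Fin.sum_univ_three]
  simp only [Fintype.sum_bool, sval]
  push_cast; ring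

/-! ## §110E.2 The station certificate -/
/-- The two LEAF KINDS of the partition tree: a basis-feasibility CONE (payload = basis index; exact, for the near-family core) or a weight
BOX (payload = box index; 64-corner convexity form of NODE 107/108C, robust, for the transverse shell). -/
inductive Leaf
  | cone (j : ℕ)
  | box (j : ℕ)
  | coneL (j k : ℕ)
  | boxL (j k : ℕ)

/-- LEAF-LOCAL CAP DATA (110F «LocalLeaf», folded in): a depth SUB-box of the hole vertices with its own cap floor and its own three 108C axis cap
blocks — a `coneL j k` / `boxL j k` leaf compares the cost with `caps[k].capLB` instead of the station's `capLB` and must derive the sub-box rows. -/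
structure LeafCap where
  /-- depth sub-box, low corner -/
  lo : Fin 3 × Bool → ℚ
  /-- depth sub-box, high corner -/
  hi : Fin 3 × Bool → ℚ
  /-- local cap lower bound (in units of `u`) -/
  capLB : ℚ
  /-- the three local axis cap certificates (108C) -/
  cap : Fin 3 → AxisCap

/-- A BOX LEAF: a weight box `[L, U]`, its corner roof bound `R` and the corner ↦ basis map (indices into the station's `bases`). -/
structure BoxLeaf where
  /-- weight box, low corner -/
  L : Fin 3 × Bool → ℚ
  /-- weight box, high corner -/
  U : Fin 3 × Bool → ℚ
  /-- corner roof bound -/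
  R : ℚ
  /-- corner ↦ basis index (64 entries, 108C bit order) -/
  cornerBasis : List ℕ

/-- ★ **THE STATION CERTIFICATE**: H-description data, unit and cap blocks (108C), LP bases, box leaves, and the partition tree. -/
structure StationCert where
  /-- the H-description (110D) -/
  R : StationRowsCert
  /-- the unit `u` of `domCapK` -/
  u : ℚ
  /-- certified cap lower bound (in units of `u`) -/
  capLB : ℚ
  /-- the three axis cap certificates (108C) -/
  cap : Fin 3 → AxisCap
  /-- LP bases (shared by cone leaves and box corners) -/
  bases : List BasisCert
  /-- box leaves -/
  boxes : List BoxLeaf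
  /-- the partition tree over `R.rows` -/
  tree : Bsp Leaf
  /-- leaf-local caps (optional; default none) -/
  caps : List LeafCap := []

/-- The verdict factor `(3/100·2·rho1)²`. -/
def StationCert.kfac (c : StationCert) : ℚ := (3 / 100 * (2 * c.R.rho1)) ^ 2

/-- The rows a leaf with basis `B` must derive: six cone facets and the verdict (an impossible row if the basis data is broken). -/
def StationCert.needB (c : StationCert) (B : BasisCert) (capLB : ℚ := c.capLB) : List LRow :=
  match B.rows? with
  | none => [⟨[], -1⟩]
  | some e => [wRow (fun q => -B.r 0 q) 0, wRow (fun q => -B.r 1 q) 0, wRow (fun q => -B.r 2 q) 0, wRow (fun q => -B.r 3 q) 0,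
      wRow (fun q => -B.r 4 q) 0, wRow (fun q => -B.r 5 q) 0, wRow (fun q => c.kfac * B.price e q) (capLB * c.u)]

/-- The twelve depth rows of a leaf-local cap: `x_q ≤ hi_q`, `−x_q ≤ −lo_q` over the hole-vertex coordinates `1..6` of `sval`, slot order 0T..2F. -/
def LeafCap.need (l : LeafCap) : List LRow :=
  [⟨unitRow 1 1, l.hi (0, true)⟩, ⟨unitRow 2 1, l.hi (0, false)⟩, ⟨unitRow 3 1, l.hi (1, true)⟩, ⟨unitRow 4 1, l.hi (1, false)⟩,
    ⟨unitRow 5 1, l.hi (2, true)⟩, ⟨unitRow 6 1, l.hi (2, false)⟩, ⟨unitRow 1 (-1), -l.lo (0, true)⟩, ⟨unitRow 2 (-1), -l.lo (0, false)⟩,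
    ⟨unitRow 3 (-1), -l.lo (1, true)⟩, ⟨unitRow 4 (-1), -l.lo (1, false)⟩, ⟨unitRow 5 (-1), -l.lo (2, true)⟩, ⟨unitRow 6 (-1), -l.lo (2, false)⟩]

/-- MEANING of the twelve rows: the hole-vertex depths lie in the sub-box. -/
theorem LeafCap.box_of_need (l : LeafCap) (dt : (Fin 3 → ℤ) → ℝ) (h : ∀ r ∈ l.need, linAt r.a (sval dt) 0 ≤ (r.b : ℝ)) :
    ∀ q, castW l.lo q ≤ dt (holeVertex 0 q) ∧ dt (holeVertex 0 q) ≤ castW l.hi q := by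
  simp only [LeafCap.need, List.mem_cons, List.not_mem_nil, or_false, forall_eq_or_imp, forall_eq, linAt_unitRow] at h
  rw [show sval dt 1 = _ from sval_pt dt (some (0, true)), show sval dt 2 = _ from sval_pt dt (some (0, false)),
    show sval dt 3 = _ from sval_pt dt (some (1, true)), show sval dt 4 = _ from sval_pt dt (some (1, false)),
    show sval dt 5 = _ from sval_pt dt (some (2, true)), show sval dt 6 = _ from sval_pt dt (some (2, false))] at h
  push_cast at h
  simp only [one_mul, neg_mul, neg_le_neg_iff] at h
  obtain ⟨u0, u1, u2, u3, u4, u5, l0, l1, l2, l3, l4, l5⟩ := h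
  rintro ⟨a, s⟩
  simp only [castW_apply]
  fin_cases a <;> cases s
  exacts [⟨l1, u1⟩, ⟨l0, u0⟩, ⟨l3, u3⟩, ⟨l2, u2⟩, ⟨l5, u5⟩, ⟨l4, u4⟩]

/-- The indicator row `s·W_q ≤ b` on the weight variables. -/
def indRow (q : Fin 3 × Bool) (s b : ℚ) : LRow := wRow (fun p => if p = q then s else 0) b

/-- [simp] its bound. -/
@[simp] theorem indRow_b (q : Fin 3 × Bool) (s b : ℚ) : (indRow q s b).b = b := rfl

/-- Its value at `sval dt` is `s · vtxW q`. -/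
theorem linAt_indRow (q : Fin 3 × Bool) (s b : ℚ) (dt : (Fin 3 → ℤ) → ℝ) :
    linAt (indRow q s b).a (sval dt) 0 = (s : ℝ) * vtxW 160 dt 0 q := by
  rw [indRow, linAt_wRow]
  have : ∀ p, (((if p = q then s else 0 : ℚ) : ℝ)) * vtxW 160 dt 0 p = if p = q then (s : ℝ) * vtxW 160 dt 0 p else 0 := by
    intro p; split <;> simp
  simp only [this, Finset.sum_ite_eq', Finset.mem_univ, if_true]

/-- The twelve rows a BOX leaf must derive: `W_q ≤ U_q` and `−W_q ≤ −L_q`, slot order 0T 0F 1T 1F 2T 2F. -/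
def BoxLeaf.need (b : BoxLeaf) : List LRow :=
  [indRow (0, true) 1 (b.U (0, true)), indRow (0, false) 1 (b.U (0, false)), indRow (1, true) 1 (b.U (1, true)),
    indRow (1, false) 1 (b.U (1, false)), indRow (2, true) 1 (b.U (2, true)), indRow (2, false) 1 (b.U (2, false)),
    indRow (0, true) (-1) (-b.L (0, true)), indRow (0, false) (-1) (-b.L (0, false)), indRow (1, true) (-1) (-b.L (1, true)),
    indRow (1, false) (-1) (-b.L (1, false)), indRow (2, true) (-1) (-b.L (2, true)), indRow (2, false) (-1) (-b.L (2, false))]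

/-- The `need` function of the tree. -/
def StationCert.need (c : StationCert) : Leaf → List LRow
  | .cone j =>
    match c.bases[j]? with
    | none => [⟨[], -1⟩]
    | some B => c.needB B
  | .box j =>
    match c.boxes[j]? with
    | none => [⟨[], -1⟩]
    | some b => b.need
  | .coneL j k =>
    match c.bases[j]?, c.caps[k]? with
    | some B, some l => c.needB B l.capLB ++ l.need
    | _, _ => [⟨[], -1⟩]
  | .boxL j k =>
    match c.boxes[j]?, c.caps[k]? with
    | some b, some l => (b.need ++ l.need) ++ [⟨[], l.capLB * c.u - c.kfac * b.R⟩]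
    | _, _ => [⟨[], -1⟩]

/-- The 108C certificate shell carrying the cap blocks (only its cap fields are read). -/
def StationCert.capCert (c : StationCert) : CostCellCert :=
  ⟨c.R.rho0, c.R.rho1, c.R.lo, c.R.hi, fun _ => 0, fun _ => 0, 0, c.u, c.capLB, [], [], c.cap⟩

/-- The 108C certificate shell of a box leaf (only its cost-block fields `L U R bases cornerBasis` are read). -/
def StationCert.boxCert (c : StationCert) (b : BoxLeaf) : CostCellCert :=
  ⟨c.R.rho0, c.R.rho1, c.R.lo, c.R.hi, b.L, b.U, b.R, c.u, c.capLB, c.bases, b.cornerBasis, c.cap⟩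

/-- The 108C certificate shell of a leaf-local cap (only its cap fields and sub-box are read). -/
def StationCert.capCertL (c : StationCert) (l : LeafCap) : CostCellCert :=
  ⟨c.R.rho0, c.R.rho1, l.lo, l.hi, fun _ => 0, fun _ => 0, 0, c.u, l.capLB, [], [], l.cap⟩

/-- The box-leaf cost block: `0 ≤ L ≤ U` and the 64 corner certificates (108C `costCheck`). -/
def StationCert.boxCost (c : StationCert) (b : BoxLeaf) : Bool :=
  (allSlots fun q => decide (0 ≤ b.L q ∧ b.L q ≤ b.U q)) && (c.boxCert b).costCheck

/-- The box-leaf block with the station verdict `kfac·R ≤ capLB·u`. -/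
def StationCert.boxCheck (c : StationCert) (b : BoxLeaf) : Bool :=
  c.boxCost b && decide (c.kfac * b.R ≤ c.capLB * c.u)

/-- The leaf-local cap block: the three 108C cap checks on the sub-box. -/
def StationCert.capCheckL (c : StationCert) (l : LeafCap) : Bool :=
  (c.capCertL l).capCheck 0 && (c.capCertL l).capCheck 1 && (c.capCertL l).capCheck 2

/-- ★★★ **THE STATION CHECKER**. -/
def StationCert.check (c : StationCert) : Bool :=
  c.R.ok && decide (0 < c.R.rho0) && c.bases.all BasisCert.invCheck && c.boxes.all c.boxCheck && c.caps.all c.capCheckL &&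
    c.capCert.capCheck 0 && c.capCert.capCheck 1 && c.capCert.capCheck 2 && c.tree.check c.need c.R.rows

/-- The impossible row is impossible. -/
theorem not_nilRow (x : ℕ → ℝ) : ¬ (∀ r ∈ [(⟨[], -1⟩ : LRow)], linAt r.a x 0 ≤ (r.b : ℝ)) := by
  intro h; have := h ⟨[], -1⟩ (by simp); simp at this; linarith

/-- ★★ MEANING OF A LEAF: a checked basis whose seven needed rows hold at `sval dt` bounds the priced roof value by the cap. -/
theorem StationCert.payload_sound (c : StationCert) {B : BasisCert} (hB : B.invCheck = true) (dt : (Fin 3 → ℤ) → ℝ) {capLB : ℚ}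
    (hneed : ∀ r ∈ c.needB B capLB, linAt r.a (sval dt) 0 ≤ (r.b : ℝ)) :
    (3 / 100 * (2 * (c.R.rho1 : ℝ))) ^ 2 * roofVal T75 (vtxW 160 dt 0) ≤ (capLB : ℝ) * c.u := by
  obtain ⟨e, he, hinv⟩ := BasisCert.invCheck_sound hB
  unfold StationCert.needB at hneed
  rw [he] at hneed
  simp only [List.mem_cons, List.not_mem_nil, or_false, forall_eq_or_imp, forall_eq] at hneed
  obtain ⟨h0, h1, h2, h3, h4, h5, hv⟩ := hneed
  rw [linAt_wRow] at h0 h1 h2 h3 h4 h5 hv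
  have hl : ∀ i, 0 ≤ basisLam (fun i q => (B.r i q : ℝ)) (vtxW 160 dt 0) i := by
    intro i
    unfold basisLam
    simp only [wRow_b, Rat.cast_zero] at h0 h1 h2 h3 h4 h5
    push_cast at h0 h1 h2 h3 h4 h5
    simp only [neg_mul, Finset.sum_neg_distrib, neg_nonpos] at h0 h1 h2 h3 h4 h5
    fin_cases i
    exacts [h0, h1, h2, h3, h4, h5]
  have hroof := roofVal_T75_le_price (BasisCert.rows?_mem he) hinv (vtxW 160 dt 0) hl
  have hprice : ∀ q, basisPrice (fun i => castRow (e i)) (fun i q => (B.r i q : ℝ)) q = (B.price e q : ℝ) := by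
    intro q; simp only [basisPrice, BasisCert.price]; rw [cast_sumFin6]; push_cast; rfl
  simp only [hprice] at hroof
  have hk : (0 : ℝ) ≤ (3 / 100 * (2 * (c.R.rho1 : ℝ))) ^ 2 := sq_nonneg _
  have hv' : (3 / 100 * (2 * (c.R.rho1 : ℝ))) ^ 2 * ∑ q, (B.price e q : ℝ) * vtxW 160 dt 0 q ≤ (capLB : ℝ) * c.u := by
    have : ∑ q, ((c.kfac * B.price e q : ℚ) : ℝ) * vtxW 160 dt 0 q = (c.kfac : ℝ) * ∑ q, (B.price e q : ℝ) * vtxW 160 dt 0 q := by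
      rw [Finset.mul_sum]; exact Finset.sum_congr rfl fun q _ => by push_cast; ring
    simp only [wRow_b] at hv
    rw [this] at hv
    have hkf : ((c.kfac : ℚ) : ℝ) = (3 / 100 * (2 * (c.R.rho1 : ℝ))) ^ 2 := by simp only [StationCert.kfac]; push_cast; ring
    rw [hkf] at hv
    exact_mod_cast hv
  exact (mul_le_mul_of_nonneg_left hroof hk).trans hv'

/-- ★★ MEANING OF A BOX LEAF: a checked box whose twelve rows hold at `sval dt` bounds the priced roof value by the cap (weights in the box ⇒
NODE 106 `roofVal_T75_le_of_corners` with the 64 corner certificates of 108C `costCheck_sound`). -/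
theorem StationCert.box_payload_sound (c : StationCert) {b : BoxLeaf} (hb : c.boxCost b = true) {capLB : ℚ}
    (hv : ((c.kfac * b.R : ℚ) : ℝ) ≤ ((capLB * c.u : ℚ) : ℝ)) (dt : (Fin 3 → ℤ) → ℝ) (hneed : ∀ r ∈ b.need, linAt r.a (sval dt) 0 ≤ (r.b : ℝ)) :
    (3 / 100 * (2 * (c.R.rho1 : ℝ))) ^ 2 * roofVal T75 (vtxW 160 dt 0) ≤ (capLB : ℝ) * c.u := by
  simp only [StationCert.boxCost, Bool.and_eq_true, decide_eq_true_eq, allSlots_iff] at hb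
  obtain ⟨hLU, hcost⟩ := hb
  simp only [BoxLeaf.need, List.mem_cons, List.not_mem_nil, or_false, forall_eq_or_imp, forall_eq, indRow_b, linAt_indRow] at hneed
  push_cast at hneed
  simp only [one_mul, neg_mul, neg_le_neg_iff] at hneed
  obtain ⟨u0, u1, u2, u3, u4, u5, l0, l1, l2, l3, l4, l5⟩ := hneed
  have hW : ∀ q, castW b.L q ≤ vtxW 160 dt 0 q ∧ vtxW 160 dt 0 q ≤ castW b.U q := by
    rintro ⟨a, s⟩
    simp only [castW_apply]
    fin_cases a <;> cases s
    exacts [⟨l1, u1⟩, ⟨l0, u0⟩, ⟨l3, u3⟩, ⟨l2, u2⟩, ⟨l5, u5⟩, ⟨l4, u4⟩]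
  have hL : ∀ q, 0 ≤ castW b.L q := fun q => by simp only [castW_apply]; exact_mod_cast (hLU q).1
  have hLU' : ∀ q, castW b.L q ≤ castW b.U q := fun q => by simp only [castW_apply]; exact_mod_cast (hLU q).2
  have hroof : roofVal T75 (vtxW 160 dt 0) ≤ (b.R : ℝ) :=
    roofVal_T75_le_of_corners hL hLU' ((c.boxCert b).costCheck_sound hcost) (vtxW 160 dt 0) hW
  have hk : (0 : ℝ) ≤ (3 / 100 * (2 * (c.R.rho1 : ℝ))) ^ 2 := sq_nonneg _
  simp only [StationCert.kfac] at hv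
  push_cast at hv
  exact (mul_le_mul_of_nonneg_left hroof hk).trans hv

/-- ★★★ **SOUNDNESS OF THE STATION CERTIFICATE**: `check = true` ⇒ the (T¹ᶜ) integrand inequality for every `ρ ∈ [rho0, rho1]` and every
chart-realisable positive depth tuple in the station's box (hole vertices in `[lo, hi]`, centre in `[loC, hiC]`). -/
theorem StationCert.sound (c : StationCert) (h : c.check = true) :
    ∀ ρ : ℝ, (c.R.rho0 : ℝ) ≤ ρ → ρ ≤ c.R.rho1 → ∀ dt : (Fin 3 → ℤ) → ℝ,
      (∀ q, castW c.R.lo q ≤ dt (holeVertex 0 q) ∧ dt (holeVertex 0 q) ≤ castW c.R.hi q) → ((c.R.loC : ℝ) ≤ dt 0 ∧ dt 0 ≤ c.R.hiC) →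
      IsChartRealisable ρ dt → (∀ p ∈ stencil 0, 0 < dt p) →
      feetHoleCost 160 (3 / 100) ρ dt 0 ≤ domCapK c.u 160 (3 / 100) ρ (chargeDepth ρ dt 0) := by
  simp only [StationCert.check, Bool.and_eq_true, decide_eq_true_eq, List.all_eq_true] at h
  obtain ⟨⟨⟨⟨⟨⟨⟨⟨hok, hρ0⟩, hbases⟩, hboxes⟩, hcaps⟩, hc0⟩, hc1⟩, hc2⟩, htree⟩ := h
  intro ρ h₀ h₁ dt hbox hC hreal hpos
  have hρ : 0 < ρ := lt_of_lt_of_le (by exact_mod_cast hρ0) h₀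
  have hbox' : ∀ q, (c.R.lo q : ℝ) ≤ dt (holeVertex 0 q) ∧ dt (holeVertex 0 q) ≤ c.R.hi q := fun q => by simpa [castW_apply] using hbox q
  have hrows := c.R.rows_sound hok h₀ h₁ hbox' hC hreal hpos
  have hcost := feetHoleCost_le_of_roofVal_le (ϱ := 160) (d := dt) (w := 0) (show (0 : ℝ) ≤ 3 / 100 by norm_num) hρ.le h₁ le_rfl
  -- the finishing move, for the station cap or a leaf-local cap: shell `k` with its three cap checks and `dt` in its box
  have finish : ∀ (k : CostCellCert), k.rho0 = c.R.rho0 → k.rho1 = c.R.rho1 → k.u = c.u →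
      k.capCheck 0 = true → k.capCheck 1 = true → k.capCheck 2 = true →
      (∀ q, castW k.lo q ≤ dt (holeVertex 0 q) ∧ dt (holeVertex 0 q) ≤ castW k.hi q) →
      (3 / 100 * (2 * (c.R.rho1 : ℝ))) ^ 2 * roofVal T75 (vtxW 160 dt 0) ≤ (k.capLB : ℝ) * c.u →
      feetHoleCost 160 (3 / 100) ρ dt 0 ≤ domCapK c.u 160 (3 / 100) ρ (chargeDepth ρ dt 0) := by
    intro k e0 e1 eu k0 k1 k2 hb hpay
    have hcap : ∀ a : Fin 3, k.capCheck a = true := fun a => by fin_cases a <;> assumption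
    have hdom := cap_at_chargeDepth (ϱ := 160) (τ := 3 / 100) hρ (e0 ▸ h₀ :) (e1 ▸ h₁ :) (fun a => k.capCheck_sound a (hcap a)) dt hb
    rw [eu] at hdom
    exact hcost.trans (hpay.trans hdom)
  obtain ⟨π, hπ⟩ := c.tree.sound c.need (sval dt) c.R.rows htree hrows
  cases π with
  | cone j =>
    simp only [StationCert.need] at hπ
    split at hπ
    · exact absurd hπ (not_nilRow _)
    · next B hB => exact finish c.capCert rfl rfl rfl hc0 hc1 hc2 hbox (c.payload_sound (hbases B (List.mem_of_getElem? hB)) dt hπ)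
  | box j =>
    simp only [StationCert.need] at hπ
    split at hπ
    · exact absurd hπ (not_nilRow _)
    · next b hb =>
      obtain ⟨hbc, hv⟩ := Bool.and_eq_true_iff.1 (hboxes b (List.mem_of_getElem? hb))
      exact finish c.capCert rfl rfl rfl hc0 hc1 hc2 hbox (c.box_payload_sound hbc (qle (of_decide_eq_true hv)) dt hπ)
  | coneL j k =>
    simp only [StationCert.need] at hπ
    split at hπ
    · next B l hB hl =>
      obtain ⟨⟨k0, k1⟩, k2⟩ := by simpa only [StationCert.capCheckL, Bool.and_eq_true] using hcaps l (List.mem_of_getElem? hl)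
      exact finish (c.capCertL l) rfl rfl rfl k0 k1 k2 (l.box_of_need dt fun r hr => hπ r (List.mem_append_right _ hr))
        (c.payload_sound (hbases B (List.mem_of_getElem? hB)) dt fun r hr => hπ r (List.mem_append_left _ hr))
    · exact absurd hπ (not_nilRow _)
  | boxL j k =>
    simp only [StationCert.need] at hπ
    split at hπ
    · next b l hb hl =>
      obtain ⟨⟨k0, k1⟩, k2⟩ := by simpa only [StationCert.capCheckL, Bool.and_eq_true] using hcaps l (List.mem_of_getElem? hl)
      obtain ⟨hbc, -⟩ := Bool.and_eq_true_iff.1 (hboxes b (List.mem_of_getElem? hb))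
      have hv : (0 : ℝ) ≤ ((l.capLB * c.u - c.kfac * b.R : ℚ) : ℝ) := by
        simpa [linAt] using hπ _ (List.mem_append_right _ (List.mem_singleton.2 rfl))
      refine finish (c.capCertL l) rfl rfl rfl k0 k1 k2 (l.box_of_need dt fun r hr => hπ r (List.mem_append_left _ (List.mem_append_right _ hr)))
        (c.box_payload_sound hbc ?_ dt fun r hr => hπ r (List.mem_append_left _ (List.mem_append_left _ hr)))
      change ((c.kfac * b.R : ℚ) : ℝ) ≤ ((l.capLB * c.u : ℚ) : ℝ)
      push_cast at hv ⊢
      linarith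
    · exact absurd hπ (not_nilRow _)

/-- ★ Batch form. -/
theorem StationCert.sound_of_all {cs : List StationCert} (h : cs.all StationCert.check = true) {c : StationCert} (hc : c ∈ cs) :
    ∀ ρ : ℝ, (c.R.rho0 : ℝ) ≤ ρ → ρ ≤ c.R.rho1 → ∀ dt : (Fin 3 → ℤ) → ℝ,
      (∀ q, castW c.R.lo q ≤ dt (holeVertex 0 q) ∧ dt (holeVertex 0 q) ≤ castW c.R.hi q) → ((c.R.loC : ℝ) ≤ dt 0 ∧ dt 0 ≤ c.R.hiC) →
      IsChartRealisable ρ dt → (∀ p ∈ stencil 0, 0 < dt p) →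
      feetHoleCost 160 (3 / 100) ρ dt 0 ≤ domCapK c.u 160 (3 / 100) ρ (chargeDepth ρ dt 0) :=
  c.sound (List.all_eq_true.mp h c hc)

end Summit.AtomisticToContinuum.Crystallization.Theorems.ChargedEnergyGapChartDial
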